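import Literature.NumberTheory.Automorphic.QuaternionLocalSplitReduction
import HarnessLib

/-!
# The Eichler order at a prime dividing the level: `|O₍ₚ₎ˣ mod p| = p² (p - 1)²`

Topic `NumberTheory/Automorphic`; theorems only (no definition, no named fact, no instance).
For a `ℤ`-order `O` of a division quaternion algebra `B` over `ℚ` whose localisation at the
prime `p` is a **local Eichler order of level `p^e`, `e ≥ 1`**, in its standard form with respect
to a matrix model `Ψ : B → M₂(ℚ_p)`,

  `O₍ₚ₎ = {x | Ψ(x) ∈ M₂(ℤ_p), Ψ(x)₂₁ ∈ p^e ℤ_p}`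

(`exists_eichler_model`, `QuaternionLocalEichlerPair.lean`; Vignéras, LNM 800, Ch. II §2
Déf. after Thm. 2.3, Lemme 2.4: `O = (R, R; p^e R, R)`), the unit group reduces modulo `p` onto
the `p² (p - 1)²` residue classes `{(a, b; p^e c, d) : a, d ∈ 𝔽_pˣ, b, c ∈ 𝔽_p}`
(`ncard_image_stabilizer_of_eichler`). The count goes through the twisted coordinates
`κ(x) = (Ψ(x)₁₁, Ψ(x)₁₂, p^{-e} Ψ(x)₂₁, Ψ(x)₂₂)`, in which `O₍ₚ₎ = κ⁻¹(ℤ_p⁴)` and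
`p O₍ₚ₎ = κ⁻¹(p ℤ_p⁴)`, so that the reduction `ρ = κ mod p` has the fibres of `O₍ₚ₎ → O₍ₚ₎/p`;
the units are the `x` with `a d - p^e b c ∈ ℤ_pˣ`, i.e. `a, d ∈ ℤ_pˣ`, and every residue is
attained by density of `Ψ(B)` (`AlgHom.exists_norm_sub_le`), as in the split case
`ncard_image_stabilizer_of_split`. This is the unit-count input, at the primes dividing the
level, of the unit-density computation of the local Euler factor of an Eichler order
(`QuaternionLocalEulerFactor.lean`: `∑_k a(p^k) p^{-2k} = p⁴ / |O₍ₚ₎ˣ mod p| = (1 - p⁻¹)⁻²`;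
Voight §26.4, Lemma 26.6.7, (26.6.9)), used for the covolume of `Γ₀^D(M)`
(`Literature.NumberTheory.Automorphic.ShimuraCurveData.volume_fd_eq`) and for Eichler's mass
formula.

## References

* M.-F. Vignéras, *Arithmétique des algèbres de quaternions*, LNM 800 (1980), Ch. II §2
  Thm. 2.3 (2), Lemme 2.4; Ch. V §2 [VignerasLNM800].
* J. Voight, *Quaternion Algebras*, GTM 288 (2021), 23.4.19, §26.4, Lemma 26.6.7 [Voight2021].
-/

open Filter Finset
open scoped Pointwise Topology

universe u

namespace Literature.NumberTheory.Automorphic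

/-! ### Counting the residues `{(a, b; c, d) : a d ≠ 0}` over `𝔽_p` -/

section Count

variable {p : ℕ} [hp : Fact p.Prime]

/-- The number of `2 × 2` matrices over `𝔽_p` with non-zero diagonal entries is `p² (p - 1)²`.
[folklore] -/
theorem ncard_diag_ne_zero_zmod :
    ({M : Matrix (Fin 2) (Fin 2) (ZMod p) | M 0 0 ≠ 0 ∧ M 1 1 ≠ 0} : Set _).ncard =
      p ^ 2 * (p - 1) ^ 2 := by
  classical
  rw [← Nat.card_coe_set_eq]
  let e : {M : Matrix (Fin 2) (Fin 2) (ZMod p) // M 0 0 ≠ 0 ∧ M 1 1 ≠ 0} ≃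
      (ZMod p × ZMod p) × ({a : ZMod p // a ≠ 0} × {d : ZMod p // d ≠ 0}) :=
    { toFun := fun M => ((M.1 0 1, M.1 1 0), (⟨M.1 0 0, M.2.1⟩, ⟨M.1 1 1, M.2.2⟩))
      invFun := fun x => ⟨!![x.2.1.1, x.1.1; x.1.2, x.2.2.1], x.2.1.2, x.2.2.2⟩
      left_inv := fun M => by
        apply Subtype.ext
        ext i j
        fin_cases i <;> fin_cases j <;> rfl
      right_inv := fun x => rfl }
  rw [Set.coe_setOf, Nat.card_congr e, Nat.card_prod, Nat.card_prod, Nat.card_prod,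
    Nat.card_congr (unitsEquivNeZero (G₀ := ZMod p)).symm, Nat.card_eq_fintype_card,
    Nat.card_eq_fintype_card, ZMod.card, ZMod.card_units p]
  ring

end Count

/-! ### `|O₍ₚ₎ˣ mod p O₍ₚ₎| = p² (p - 1)²` for the local Eichler order of level `p^e`, `e ≥ 1` -/

section UnitCount

variable {B : Type u} [Ring B] [Algebra ℚ B] [IsQuaternionAlgebra ℚ B] {p : ℕ} [hp : Fact p.Prime]

/-- **`|O₍ₚ₎ˣ mod p O₍ₚ₎| = p² (p - 1)²` for a local Eichler order of level `p^e`, `e ≥ 1`**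
(Vignéras II §2: `O_p = (ℤ_p, ℤ_p; p^e ℤ_p, ℤ_p)`, whose units are the elements with unit
diagonal modulo `p`; the twisted reduction `(a, b, p^{-e} c, d) mod p` is surjective by density
and a unit diagonal lifts to a unit of `O₍ₚ₎`). [cite: VignerasLNM800, Ch. II §2 Thm. 2.3 (2) and Lemme 2.4] [cite: Voight2021, Lemma 26.6.7] -/
theorem ncard_image_stabilizer_of_eichler (hdiv : ∀ x : B, x ≠ 0 → IsUnit x)
    (Ψ : B →ₐ[ℚ] Matrix (Fin 2) (Fin 2) ℚ_[p]) {O : Submodule ℤ B} (hO : IsZOrder O) {e : ℕ}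
    (he : 1 ≤ e)
    (hΛ : ∀ x : B, x ∈ localAt p O ↔ (∀ i j, ‖Ψ x i j‖ ≤ 1) ∧ ‖Ψ x 1 0‖ ≤ (p : ℝ) ^ (-(e : ℤ))) :
    (QuotientAddGroup.mk '' (Units.val '' (MulAction.stabilizer Bˣ (localAt p O) : Set Bˣ)) :
      Set (B ⧸ (((p : ℤ) ^ 1) • localAt p O).toAddSubgroup)).ncard = p ^ 2 * (p - 1) ^ 2 := by
  classical
  have hpp : p.Prime := hp.out
  have hp0 : (p : ℚ_[p]) ≠ 0 := Nat.cast_ne_zero.mpr hpp.ne_zero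
  have hpQ : (p : ℚ) ≠ 0 := Nat.cast_ne_zero.mpr hpp.ne_zero
  have hpR : (0 : ℝ) < p := by exact_mod_cast hpp.pos
  have hp1 : (1 : ℝ) < p := by exact_mod_cast hpp.one_lt
  haveI : Nontrivial B := Module.nontrivial_of_finrank_pos (R := ℚ)
    (by rw [IsQuaternionAlgebra.finrank_eq_four (K := ℚ) (D := B)]; norm_num)
  -- the uniformising power `π = p^e` and its norm
  set π : ℚ_[p] := (p : ℚ_[p]) ^ e with hπ
  have hπ0 : π ≠ 0 := pow_ne_zero e hp0
  have hπnorm : ‖π‖ = (p : ℝ) ^ (-(e : ℤ)) := by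
    rw [hπ, norm_pow, Padic.norm_p, inv_pow, ← zpow_natCast, ← zpow_neg]
  have hπinv : ‖π⁻¹‖ = (p : ℝ) ^ (e : ℤ) := by
    rw [norm_inv, hπnorm, ← zpow_neg, neg_neg]
  have hpe1 : (p : ℝ) ^ (-(e : ℤ)) < 1 := zpow_lt_one_of_neg₀ hp1 (by omega)
  have hpe_le : (p : ℝ) ^ (-(e : ℤ)) ≤ (p : ℝ)⁻¹ := by
    rw [← zpow_neg_one]
    exact zpow_le_zpow_right₀ hp1.le (by omega)
  -- the twisted coordinates `κ`
  let κ : B → Fin 2 → Fin 2 → ℚ_[p] := fun x i j =>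
    if i = 1 ∧ j = 0 then π⁻¹ * Ψ x 1 0 else Ψ x i j
  have hκ10 : ∀ x, κ x 1 0 = π⁻¹ * Ψ x 1 0 := fun x => by simp [κ]
  have hκne : ∀ x i j, ¬ (i = 1 ∧ j = 0) → κ x i j = Ψ x i j := fun x i j h => by
    simp only [κ, if_neg h]
  have hκsub : ∀ x y i j, κ (y - x) i j = κ y i j - κ x i j := by
    intro x y i j
    by_cases h : i = 1 ∧ j = 0
    · obtain ⟨rfl, rfl⟩ := h
      rw [hκ10, hκ10, hκ10, map_sub, Matrix.sub_apply, mul_sub]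
    · rw [hκne _ _ _ h, hκne _ _ _ h, hκne _ _ _ h, map_sub, Matrix.sub_apply]
  have hκsmul : ∀ (c : ℚ) (x : B) i j, κ (c • x) i j = (c : ℚ_[p]) * κ x i j := by
    intro c x i j
    have hsm : ∀ i' j', Ψ (c • x) i' j' = (c : ℚ_[p]) * Ψ x i' j' := by
      intro i' j'
      rw [map_smul, Matrix.smul_apply, ← IsScalarTower.algebraMap_smul ℚ_[p] c (Ψ x i' j'),
        smul_eq_mul]
      rfl
    by_cases h : i = 1 ∧ j = 0
    · obtain ⟨rfl, rfl⟩ := h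
      rw [hκ10, hκ10, hsm]; ring
    · rw [hκne _ _ _ h, hκne _ _ _ h, hsm]
  -- `O₍ₚ₎` and `p O₍ₚ₎` in the coordinates `κ`
  have hΛκ : ∀ x : B, x ∈ localAt p O ↔ ∀ i j, ‖κ x i j‖ ≤ 1 := by
    intro x
    rw [hΛ]
    constructor
    · rintro ⟨h1, h2⟩ i j
      by_cases h : i = 1 ∧ j = 0
      · obtain ⟨rfl, rfl⟩ := h
        rw [hκ10, norm_mul, hπinv]
        calc (p : ℝ) ^ (e : ℤ) * ‖Ψ x 1 0‖ ≤ (p : ℝ) ^ (e : ℤ) * (p : ℝ) ^ (-(e : ℤ)) :=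
              mul_le_mul_of_nonneg_left h2 (zpow_nonneg hpR.le _)
          _ = 1 := by rw [← zpow_add₀ hpR.ne', add_neg_cancel, zpow_zero]
      · rw [hκne _ _ _ h]; exact h1 i j
    · intro h
      have h10 : ‖Ψ x 1 0‖ ≤ (p : ℝ) ^ (-(e : ℤ)) := by
        have h' := h 1 0
        rw [hκ10, norm_mul, hπinv] at h'
        have hpos : (0 : ℝ) < (p : ℝ) ^ (e : ℤ) := zpow_pos hpR _
        calc ‖Ψ x 1 0‖ = ((p : ℝ) ^ (e : ℤ))⁻¹ * ((p : ℝ) ^ (e : ℤ) * ‖Ψ x 1 0‖) := by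
              rw [← mul_assoc, inv_mul_cancel₀ hpos.ne', one_mul]
          _ ≤ ((p : ℝ) ^ (e : ℤ))⁻¹ * 1 := mul_le_mul_of_nonneg_left h' (inv_nonneg.mpr hpos.le)
          _ = (p : ℝ) ^ (-(e : ℤ)) := by rw [mul_one, zpow_neg]
      refine ⟨fun i j => ?_, h10⟩
      by_cases h' : i = 1 ∧ j = 0
      · obtain ⟨rfl, rfl⟩ := h'
        exact h10.trans hpe1.le
      · rw [← hκne x i j h']; exact h i j
  -- the reduction map
  let ρ : B → Matrix (Fin 2) (Fin 2) (ZMod p) := fun x =>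
    Matrix.of fun i j => if h : ‖κ x i j‖ ≤ 1 then PadicInt.toZMod ⟨κ x i j, h⟩ else 0
  have hρ : ∀ {x : B} (hx : ∀ i j, ‖κ x i j‖ ≤ 1) (i j : Fin 2),
      ρ x i j = PadicInt.toZMod ⟨κ x i j, hx i j⟩ := fun hx i j => by
    simp only [ρ, Matrix.of_apply, dif_pos (hx i j)]
  set G : Set B := Units.val '' (MulAction.stabilizer Bˣ (localAt p O) : Set Bˣ) with hG
  set K : Submodule ℤ B := ((p : ℤ) ^ 1) • localAt p O with hK
  have hGΛ : ∀ x ∈ G, ∀ i j, ‖κ x i j‖ ≤ 1 := by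
    rintro _ ⟨u, hu, rfl⟩
    exact (hΛκ _).mp (hO.mem_stabilizer_localAt_iff.mp hu).1
  -- (K1) same fibres as reduction modulo `p O₍ₚ₎`
  have hmemK : ∀ x y : B, -x + y ∈ K ↔ ∀ i j, ‖κ (y - x) i j‖ ≤ (p : ℝ)⁻¹ := by
    intro x y
    rw [hK, pow_one]
    constructor
    · intro h
      obtain ⟨w, hw, hwe⟩ := (Submodule.mem_smul_pointwise_iff_exists _ _ _).mp h
      have hw' := (hΛκ w).mp hw
      intro i j
      have : y - x = (p : ℚ) • w := by
        rw [sub_eq_neg_add, ← hwe, natCast_zsmul_eq_ratCast_smul]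
      rw [this, hκsmul, norm_mul, Rat.cast_natCast, Padic.norm_p]
      exact mul_le_of_le_one_right (inv_nonneg.mpr (Nat.cast_nonneg _)) (hw' i j)
    · intro h
      refine (Submodule.mem_smul_pointwise_iff_exists _ _ _).mpr ⟨(p : ℚ)⁻¹ • (y - x), ?_, ?_⟩
      · rw [hΛκ]
        intro i j
        rw [hκsmul, norm_mul, Rat.cast_inv, Rat.cast_natCast, norm_inv, Padic.norm_p, inv_inv]
        calc (p : ℝ) * ‖κ (y - x) i j‖ ≤ (p : ℝ) * (p : ℝ)⁻¹ :=
              mul_le_mul_of_nonneg_left (h i j) (Nat.cast_nonneg _)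
          _ = 1 := mul_inv_cancel₀ (by exact_mod_cast hpp.ne_zero)
      · rw [natCast_zsmul_eq_ratCast_smul, smul_smul, mul_inv_cancel₀ hpQ, one_smul, sub_eq_neg_add]
  have hfib : ∀ x ∈ G, ∀ y ∈ G, ((QuotientAddGroup.mk x : B ⧸ K.toAddSubgroup) = QuotientAddGroup.mk y
      ↔ ρ x = ρ y) := by
    intro x hx y hy
    have hx' := hGΛ x hx
    have hy' := hGΛ y hy
    rw [QuotientAddGroup.eq]
    change -x + y ∈ K ↔ _
    rw [hmemK]
    have hentry : ∀ i j, ‖(⟨κ x i j, hx' i j⟩ - ⟨κ y i j, hy' i j⟩ : ℤ_[p])‖ = ‖κ (y - x) i j‖ := by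
      intro i j
      rw [hκsub, ← norm_neg (κ y i j - κ x i j), neg_sub]; rfl
    constructor
    · intro h
      ext i j
      rw [hρ hx', hρ hy', PadicInt.toZMod_eq_toZMod_iff, PadicInt.norm_lt_one_iff_norm_le_inv, hentry]
      exact h i j
    · intro h i j
      have hij := congr_fun (congr_fun h i) j
      rw [hρ hx', hρ hy', PadicInt.toZMod_eq_toZMod_iff, PadicInt.norm_lt_one_iff_norm_le_inv,
        hentry] at hij
      exact hij
  -- norms of the diagonal entries of a matrix of unit determinant with small lower-left entry
  have hdiag : ∀ {W : Matrix (Fin 2) (Fin 2) ℚ_[p]}, (∀ i j, ‖W i j‖ ≤ 1) → ‖W 1 0‖ < 1 →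
      ‖W.det‖ = 1 → ‖W 0 0‖ = 1 ∧ ‖W 1 1‖ = 1 := by
    intro W hW h10 hdet
    rw [Matrix.det_fin_two] at hdet
    have hbc : ‖W 0 1 * W 1 0‖ < 1 := by
      rw [norm_mul]
      calc ‖W 0 1‖ * ‖W 1 0‖ ≤ 1 * ‖W 1 0‖ := mul_le_mul_of_nonneg_right (hW 0 1) (norm_nonneg _)
        _ < 1 := by rw [one_mul]; exact h10
    have had : ‖W 0 0 * W 1 1‖ = 1 := by
      by_contra hne
      have hlt : ‖W 0 0 * W 1 1‖ < 1 := by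
        rw [norm_mul]
        exact lt_of_le_of_ne (mul_le_one₀ (hW 0 0) (norm_nonneg _) (hW 1 1))
          (by rwa [norm_mul] at hne)
      have : ‖W 0 0 * W 1 1 - W 0 1 * W 1 0‖ < 1 := by
        rw [sub_eq_add_neg]
        refine lt_of_le_of_lt (Padic.nonarchimedean _ _) (max_lt hlt ?_)
        rwa [norm_neg]
      exact this.ne hdet
    rw [norm_mul] at had
    have h00 : ‖W 0 0‖ ≤ 1 := hW 0 0
    have h11 : ‖W 1 1‖ ≤ 1 := hW 1 1
    constructor
    · refine le_antisymm h00 ?_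
      by_contra hlt
      rw [not_le] at hlt
      have : ‖W 0 0‖ * ‖W 1 1‖ < 1 := by
        calc ‖W 0 0‖ * ‖W 1 1‖ ≤ ‖W 0 0‖ * 1 := mul_le_mul_of_nonneg_left h11 (norm_nonneg _)
          _ < 1 := by rw [mul_one]; exact hlt
      exact this.ne had
    · refine le_antisymm h11 ?_
      by_contra hlt
      rw [not_le] at hlt
      have : ‖W 0 0‖ * ‖W 1 1‖ < 1 := by
        calc ‖W 0 0‖ * ‖W 1 1‖ ≤ 1 * ‖W 1 1‖ := mul_le_mul_of_nonneg_right h00 (norm_nonneg _)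
          _ < 1 := by rw [one_mul]; exact hlt
      exact this.ne had
  -- (K2) the image of the units is `{a ≠ 0, d ≠ 0}`
  have himage : ρ '' G = {M : Matrix (Fin 2) (Fin 2) (ZMod p) | M 0 0 ≠ 0 ∧ M 1 1 ≠ 0} := by
    ext M
    simp only [Set.mem_image, Set.mem_setOf_eq]
    constructor
    · rintro ⟨x, hx, rfl⟩
      obtain ⟨u, hu, rfl⟩ := hx
      have hu' := hO.mem_stabilizer_localAt_iff.mp hu
      obtain ⟨h1, h1c⟩ := (hΛ _).mp hu'.1
      obtain ⟨h2, -⟩ := (hΛ _).mp hu'.2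
      have hGL : Ψ (u : B) ∈ padicGL2 p := by
        refine mem_padicGL2_of_inv h1 ((Matrix.isUnit_iff_isUnit_det _).mp ((Units.isUnit u).map Ψ)) ?_
        rw [← algHom_units_inv Ψ u]
        exact h2
      have hκu : ∀ i j, ‖κ (u : B) i j‖ ≤ 1 := (hΛκ _).mp hu'.1
      obtain ⟨h00, h11⟩ := hdiag h1 (lt_of_le_of_lt h1c hpe1) hGL.2
      refine ⟨?_, ?_⟩
      · rw [hρ hκu, Ne, PadicInt.toZMod_eq_zero_iff, not_lt]
        change 1 ≤ ‖κ (u : B) 0 0‖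
        rw [hκne _ _ _ (by simp)]
        exact h00.ge
      · rw [hρ hκu, Ne, PadicInt.toZMod_eq_zero_iff, not_lt]
        change 1 ≤ ‖κ (u : B) 1 1‖
        rw [hκne _ _ _ (by simp)]
        exact h11.ge
    · rintro ⟨hM00, hM11⟩
      -- lift `M` and approximate to precision `p^{-(e+1)}`
      let Mt : Matrix (Fin 2) (Fin 2) ℚ_[p] := fun i j =>
        if i = 1 ∧ j = 0 then π * ((M 1 0).val : ℚ_[p]) else ((M i j).val : ℚ_[p])
      obtain ⟨b, hb⟩ := AlgHom.exists_norm_sub_le Ψ Mt (e + 1)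
      have hpe' : (p : ℝ) ^ (-((e + 1 : ℕ) : ℤ)) < (p : ℝ) ^ (-(e : ℤ)) :=
        zpow_lt_zpow_right₀ hp1 (by push_cast; omega)
      have hpe'1 : (p : ℝ) ^ (-((e + 1 : ℕ) : ℤ)) < 1 := hpe'.trans hpe1
      have hval1 : ∀ i j, ‖((M i j).val : ℚ_[p])‖ ≤ 1 := fun i j =>
        IsUltrametricDist.norm_natCast_le_one ℚ_[p] _
      have hMt : ∀ i j, ‖Mt i j‖ ≤ 1 := by
        intro i j
        by_cases h : i = 1 ∧ j = 0
        · obtain ⟨rfl, rfl⟩ := h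
          simp only [Mt, and_self, if_true]
          rw [norm_mul, hπnorm]
          exact mul_le_one₀ hpe1.le (norm_nonneg _) (hval1 1 0)
        · simp only [Mt, if_neg h]; exact hval1 i j
      have hMt10 : ‖Mt 1 0‖ ≤ (p : ℝ) ^ (-(e : ℤ)) := by
        simp only [Mt, and_self, if_true]
        rw [norm_mul, hπnorm]
        exact mul_le_of_le_one_right (zpow_nonneg hpR.le _) (hval1 1 0)
      have hbint : ∀ i j, ‖Ψ b i j‖ ≤ 1 := by
        intro i j
        have : Ψ b i j = Mt i j + (Ψ b - Mt) i j := by rw [Matrix.sub_apply]; ring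
        rw [this]
        exact (Padic.nonarchimedean _ _).trans (max_le (hMt i j) ((hb i j).trans hpe'1.le))
      have hb10 : ‖Ψ b 1 0‖ ≤ (p : ℝ) ^ (-(e : ℤ)) := by
        have : Ψ b 1 0 = Mt 1 0 + (Ψ b - Mt) 1 0 := by rw [Matrix.sub_apply]; ring
        rw [this]
        exact (Padic.nonarchimedean _ _).trans (max_le hMt10 ((hb 1 0).trans hpe'.le))
      have hbΛ : b ∈ localAt p O := (hΛ b).mpr ⟨hbint, hb10⟩
      have hκb : ∀ i j, ‖κ b i j‖ ≤ 1 := (hΛκ b).mp hbΛ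
      -- `ρ b = M`
      have hρb : ρ b = M := by
        ext i j
        rw [hρ hκb]
        have hcong : PadicInt.toZMod (⟨κ b i j, hκb i j⟩ : ℤ_[p]) =
            PadicInt.toZMod ((M i j).val : ℤ_[p]) := by
          rw [PadicInt.toZMod_eq_toZMod_iff, PadicInt.norm_def, PadicInt.coe_sub, PadicInt.coe_natCast]
          by_cases h : i = 1 ∧ j = 0
          · obtain ⟨rfl, rfl⟩ := h
            change ‖κ b 1 0 - ((M 1 0).val : ℚ_[p])‖ < 1
            have : κ b 1 0 - ((M 1 0).val : ℚ_[p]) = π⁻¹ * (Ψ b - Mt) 1 0 := by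
              rw [hκ10, Matrix.sub_apply]
              simp only [Mt, and_self, if_true]
              field_simp
            rw [this, norm_mul, hπinv]
            calc (p : ℝ) ^ (e : ℤ) * ‖(Ψ b - Mt) 1 0‖ ≤ (p : ℝ) ^ (e : ℤ) * (p : ℝ) ^ (-((e + 1 : ℕ) : ℤ)) :=
                  mul_le_mul_of_nonneg_left (hb 1 0) (zpow_nonneg hpR.le _)
              _ = (p : ℝ)⁻¹ := by
                  rw [← zpow_add₀ hpR.ne', ← zpow_neg_one]; congr 1; push_cast; ring
              _ < 1 := inv_lt_one_of_one_lt₀ hp1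
          · change ‖κ b i j - ((M i j).val : ℚ_[p])‖ < 1
            rw [hκne _ _ _ h]
            have : ((M i j).val : ℚ_[p]) = Mt i j := by simp only [Mt, if_neg h]
            rw [this, ← Matrix.sub_apply]
            exact lt_of_le_of_lt (hb i j) hpe'1
        rw [hcong, map_natCast, ZMod.natCast_zmod_val]
      -- `det Ψ b` is a unit
      have hdet1 : ‖(Ψ b).det‖ = 1 := by
        have ha : ‖Ψ b 0 0‖ = 1 := by
          refine le_antisymm (hbint 0 0) (not_lt.mp fun hlt => hM00 ?_)
          have h := congr_fun (congr_fun hρb 0) 0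
          rw [← h, hρ hκb, PadicInt.toZMod_eq_zero_iff]
          change ‖κ b 0 0‖ < 1
          rwa [hκne _ _ _ (by simp)]
        have hd : ‖Ψ b 1 1‖ = 1 := by
          refine le_antisymm (hbint 1 1) (not_lt.mp fun hlt => hM11 ?_)
          have h := congr_fun (congr_fun hρb 1) 1
          rw [← h, hρ hκb, PadicInt.toZMod_eq_zero_iff]
          change ‖κ b 1 1‖ < 1
          rwa [hκne _ _ _ (by simp)]
        rw [Matrix.det_fin_two, sub_eq_add_neg]
        have had : ‖Ψ b 0 0 * Ψ b 1 1‖ = 1 := by rw [norm_mul, ha, hd, mul_one]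
        have hbc : ‖-(Ψ b 0 1 * Ψ b 1 0)‖ < 1 := by
          rw [norm_neg, norm_mul]
          calc ‖Ψ b 0 1‖ * ‖Ψ b 1 0‖ ≤ 1 * ‖Ψ b 1 0‖ :=
                mul_le_mul_of_nonneg_right (hbint 0 1) (norm_nonneg _)
            _ < 1 := by rw [one_mul]; exact lt_of_le_of_lt hb10 hpe1
        rw [Padic.add_eq_max_of_ne (by rw [had]; exact hbc.ne'), had, max_eq_left hbc.le]
      have hb0 : b ≠ 0 := by
        intro h; rw [h, map_zero, Matrix.det_zero, norm_zero] at hdet1; exact zero_ne_one hdet1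
      set ub := (hdiv b hb0).unit with hub
      have hubv : (ub : B) = b := IsUnit.unit_spec _
      have hGLb : Ψ b ∈ padicGL2 p := ⟨hbint, hdet1⟩
      -- the inverse lies in `O₍ₚ₎`: integral entries, lower-left entry `-c / det`
      have hinvint : ∀ i j, ‖Ψ ((ub⁻¹ : Bˣ) : B) i j‖ ≤ 1 := by
        rw [algHom_units_inv Ψ, hubv]
        exact (inv_mem_padicGL2 hGLb).1
      have hinv10 : ‖Ψ ((ub⁻¹ : Bˣ) : B) 1 0‖ ≤ (p : ℝ) ^ (-(e : ℤ)) := by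
        rw [algHom_units_inv Ψ, hubv, Matrix.inv_def, Matrix.adjugate_fin_two, Matrix.smul_apply,
          smul_eq_mul, norm_mul]
        simp only [Matrix.of_apply, Matrix.cons_val', Matrix.cons_val_zero, Matrix.cons_val_one,
          Matrix.empty_val', Matrix.cons_val_fin_one]
        have hri : ‖Ring.inverse (Ψ b).det‖ = 1 := by
          rw [Ring.inverse_eq_inv', norm_inv, hdet1, inv_one]
        rw [hri, one_mul, norm_neg]
        exact hb10
      refine ⟨b, ⟨ub, hO.mem_stabilizer_localAt_iff.mpr ⟨?_, (hΛ _).mpr ⟨hinvint, hinv10⟩⟩, hubv⟩, hρb⟩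
      rw [hubv]; exact hbΛ
  rw [ncard_image_mk_eq_ncard_image ρ hfib, himage, ncard_diag_ne_zero_zmod]

end UnitCount

end Literature.NumberTheory.Automorphic
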